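import Literature.NumberTheory.GaloisRepresentations.GalLayerSystemHom
import HarnessLib

/-!
# Morphisms of Galois layer systems on the layers: the restriction of `lim φ` to the `Gal(F̄/E)`-invariants is `φ_E`,
# and so is the induced map on `Hⁿ(Γ_F ⧸ U_E, ·)` under the layer cohomology isomorphisms
# (Tate, C–F VII §11.1; Serre, *Galois Cohomology* I §2.2)

Topic `NumberTheory/GaloisRepresentations`; namespace `Literature.NumberTheory.GaloisRepresentations.GalLayerData.Hom`.
Sequel to `GalLayerSystemHom.lean` (door-c5 g16: `φ.limitHom : lim D ⟶ lim D'` in `DiscreteRepCat ℤ Γ_F`) and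
`GalLayerSystemLayers.lean` (`D.layerEquiv`, `D.layerCohomologyIso E n : Hⁿ(Γ_F ⧸ U_E, (lim D)^{U_E}) ≅ Hⁿ(Gal(E/F), D.obj E)`).
Theorems only; NO named fact, no `sorry`, no instance, no notation.  Route A of crux `AnticycControlAdditiveK` (item 19295):
with `GalLayerSystemSES.lean` it says that, layer by layer, the limit sequence `0 → lim→ Eˣ → J̄ → C̄ → 0` restricted to
`U_E`-invariants and its cohomology over `Γ_F ⧸ U_E ≃* Gal(E/F)` ARE the finite-layer sequence `Eˣ → J_E → C_E` and its
cohomology (Tate VII §11.1: the exact commutative diagram of a tower, passage to the limit).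

Mathematics.  For a morphism of systems `φ : D → D'` and a layer `E`, door-c4's functor `M ↦ M^{U_E}`
(`DiscreteRep.invariantsQuotFunctor ℤ U_E`) applied to `lim φ` is, under the identifications `(lim D)^{U_E} ≅ D.obj E`, the
layer map `φ_E` (both are restrictions of `lim φ`, which is `φ_E` on the image of `D.obj E`); consequently the induced map
`Hⁿ(Γ_F ⧸ U_E, (lim D)^{U_E}) → Hⁿ(Γ_F ⧸ U_E, (lim D')^{U_E})` corresponds to `Hⁿ(Gal(E/F), φ_E)` (functoriality of group
cohomology in the module; proved on inhomogeneous cochains, where Mathlib's `cochainsMap_comp` is definitional).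

## What is formalised (`F : Type` a number field, `Γ = absoluteGaloisGroup F`, `φ : D.Hom D'`)

* **`layerEquiv_invariantsQuotFunctor_map`**: `D'.layerEquiv E ((M ↦ M^{U_E})(lim φ) z) = φ_E (D.layerEquiv E z)`.
* **`functor_map_comp_layerCohomologyIso`** (proved on inhomogeneous cochains):
  `Hⁿ(Γ⧸U_E, (lim φ)^{U_E}) ≫ iso_{D',E} = iso_{D,E} ≫ Hⁿ(Gal(E/F), φ_E)` (Mathlib `groupCohomology.functor`).

## References
* J. W. S. Cassels, A. Fröhlich (eds.), *Algebraic Number Theory* (1967), Ch. VII (J. Tate) §11.1. [CasselsFrohlichANT1967]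
* J.-P. Serre, *Galois Cohomology*, Springer (1997), I §2.2. [SerreGaloisCohomology1997]
-/

noncomputable section

open CategoryTheory CategoryTheory.Limits groupCohomology
open Field (absoluteGaloisGroup)
open Literature.Algebra.Homology
open scoped Classical

namespace Literature.NumberTheory.GaloisRepresentations

open IdeleClassBar

namespace GalLayerData

namespace Hom

variable {F : Type} [Field F] [NumberField F] {D D' : GalLayerData F} (φ : Hom D D')

omit [NumberField F] in
/-- **The restriction of `lim φ` to the `U_E`-invariants is `φ_E`** under the layer identifications
`(lim D)^{U_E} ≅ D.obj E`, `(lim D')^{U_E} ≅ D'.obj E`. [cite: CasselsFrohlichANT1967, Ch. VII §11.1] -/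
theorem layerEquiv_invariantsQuotFunctor_map (E : GalLayer F) (z : (D.layerRep E).V) :
    D'.layerEquiv E (((DiscreteRep.invariantsQuotFunctor ℤ
        (E.openNormalSubgroup : Subgroup (absoluteGaloisGroup F))).map φ.limitHom).hom z) =
      φ.app E (D.layerEquiv E z) := by
  rw [GalLayerData.layerEquiv_eq_iff]
  change φ.limitMap (z.1 : D.toSystem.limit) = _
  rw [← D.of_layerEquiv E z, limitMap_of]

/-- **`Hⁿ(Γ_F ⧸ U_E, (lim φ)^{U_E}) ≫ iso_{D',E} = iso_{D,E} ≫ Hⁿ(Gal(E/F), φ_E)`**: under the layer cohomology isomorphisms,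
the map induced by `lim φ` on door-c4's layers is the map induced by `φ_E` (Mathlib `groupCohomology.functor`, i.e.
functoriality in the module). [cite: CasselsFrohlichANT1967, Ch. VII §11.1][cite: SerreGaloisCohomology1997, I §2.2] -/
theorem functor_map_comp_layerCohomologyIso (E : GalLayer F) (n : ℕ) :
    (groupCohomology.functor ℤ
          (absoluteGaloisGroup F ⧸ (E.openNormalSubgroup : Subgroup (absoluteGaloisGroup F))) n).map
        ((DiscreteRep.invariantsQuotFunctor ℤ (E.openNormalSubgroup : Subgroup (absoluteGaloisGroup F))).map
          φ.limitHom) ≫ (D'.layerCohomologyIso E n).hom =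
      (D.layerCohomologyIso E n).hom ≫ (groupCohomology.functor ℤ (E.1 ≃ₐ[F] E.1) n).map (φ.appRepHom E) := by
  change HomologicalComplex.homologyMap _ n ≫ HomologicalComplex.homologyMap _ n =
    HomologicalComplex.homologyMap _ n ≫ HomologicalComplex.homologyMap _ n
  rw [← HomologicalComplex.homologyMap_comp, ← HomologicalComplex.homologyMap_comp]
  -- the two composite cochain maps agree: both send `x` to `g ↦ φ_E (layerEquiv (x (quotEquiv⁻¹ ∘ g)))`
  congr 1
  refine HomologicalComplex.hom_ext _ _ fun i => ModuleCat.hom_ext (LinearMap.ext fun x => funext fun g => ?_)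
  exact φ.layerEquiv_invariantsQuotFunctor_map E _

end Hom

end GalLayerData

end Literature.NumberTheory.GaloisRepresentations

end
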